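import Literature.MathematicalPhysics.QuantumFieldTheory.Balaban1983to89.B4LeafRegular
import Literature.MathematicalPhysics.QuantumFieldTheory.Balaban1983to89.DagDischargedII

/-!
# NODE 00 (YM-PLAN Track A) — the B4 group of the carrier bundle `X : DagBinding.PrintedCarriersR` AT THE CONCRETE OBJECTS of
# [Balaban1983RegularityDecay] (regular field `A ≠ 0`, torus region pairs), assembled from the tree (`B4LeafRegular`), and what it gives the
# DAG node N01 (`Dag.B4_main`) over the N-binding `Upstream.ofPrintedAllXPN`

NODE 00 STAGE-1 MODULE (seat `pub-ymgap-node00-def`, YM-PLAN §2a NODE 00; root module of record `Node00Carriers`, whose CONVENTIONS OF RECORD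
block applies here), NOT by itself a discharge booking (node rows are booked by the plan seat and the leads).  HONEST FRAMING: definitions + kernel bookkeeping; the only analytic content is the lit-balaban theorem
`B4LeafRegular.leafNN_torusPairFam` (r01 gen 11: Theorem p. 573 in its `0 ≤ α` form `ThmPrintedNN` ∧ «Prop. 2.3 of [1]» ∧ «Prop. 3.1′ of [2]» ∧
the Sect. 5 Theorem, for the concrete torus ∕ lattice families at a (1.7)-regular field), cited by name.  Nothing of the series' end statement; no
continuum ∕ mass-gap claim.

WHAT THIS FILE SHOWS (scoping report NODE00-SCOPING.md v0.1 §2.3, §3 F2b, §5 Q-N00-7):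
* `Node00.withB4 X famE famU famF d4 N4` — generic plumbing: `X` with its whole B4 group (index types included) replaced;
* `Node00.withB4OfRecord … X` — the B4 group := the r01 lineage's families with EVERY field genuine: `famE := B4TorusPairFam.torusPairFam`
  (torus region pairs `Ω ⊂ Ω₀ ⊂ T_η`, regular `A`, big-block size `Kmod`), `famU := B4Prop23RegularWindow.regularFieldRegionsW`, `famF :=
  B4Prop31Regular.regularFormSetting`, `(d4, N4) := (d₅, N₅)`;
* `b4N_withB4OfRecord` — at these carriers the `b4` leaf OF THE N-BINDING `Upstream.ofPrintedAllXPN` (`DagDischargedII.B4LeafNN`: conjunct 1 =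
  `ThmPrintedNN`, the referee-ruled faithful reading G-ref1-32) HOLDS outright, for every orthogonal one-parameter flow with a Lipschitz bound (the
  printed `U = e^{tq}` is `B4Eq12ExpFlow.expFlow q`, cf. `B4LeafRegular.leafNN_torusPairFam_exp`) and all admissible family parameters;
* `b4_main_withB4OfRecord` — hence `Dag.B4_main (DagBinding.leavesP w P)` (= the venue's `YMDAG.N01 w P`) for EVERY binding world `w` whose upstream
  block is `ofPrintedAllXPN (withB4OfRecord … X) Y Z V W`, every run `P`;
* `not_stated_for_P_binding` (doc remark only): over the P-binding `ofPrintedAllXP` the `b4` leaf is `B4.LeafB4` with the LITERAL `ThmPrinted` («∀ α < 1»),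
  refuted as typed at b04's zero-field carriers (`DagDischargedII.ofPrintedAllXP_b4_false_of_boxFamB`-type negative edge, node 16) — this file makes NO
  statement about the P-binding at the r01 carriers.
LOCATED READINGS inherited from the lineage (listed for the cross-read and rulings Q-N00-3∕7, not adjudicated here): abelian one-parameter flow (1.2) (AS
PRINTED in [B4]); component fields; ℓ^∞ torus metric in unit-lattice units; distances to empty sets := 0 under the `rect` waiver (full torus);
staircase ∕ admissible torus contours; big-block size `M = Kmod …` CHOSEN (`Classical.choose`; print: «M a large positive integer defined later in this
paper»); fine period `nP_ν ≥ 3`; `L = ℓ + 1 ≥ 2` (print [B12]: L odd > 11 — compatible).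
-/

noncomputable section

namespace Literature.MathematicalPhysics.QuantumFieldTheory.Balaban1983to89.Node00

open scoped Matrix
open DagBinding DagDischargedII B4GaugeCovariance
open B4ThmRegionPairEta (Kmod) 
open B4TorusPairFam (TorusPairInst torusPairFam)
open B4Prop23RegularWindow (regularFieldRegionsW)
open B4Prop31Regular (regularFormSetting)
open B4LeafRegular (leafNN_torusPairFam)

/-- Generic plumbing: the carrier bundle `X` with its whole B4 group ([Balaban1983RegularityDecay]: index types `I4E I4U I4F`, families
`famE famU famF`, and `(d4, N4)` of the Sect. 5 Theorem) replaced; every other group unchanged. [folklore] -/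
def withB4 (X : PrintedCarriersR) {I₁ I₂ I₃ : Type} (famE : I₁ → B4.EtaSetting)
    (famU : I₂ → B4.UnitSetting) (famF : I₃ → B4.FormSetting) (d4 N4 : ℕ) : PrintedCarriersR :=
  { X with I4E := I₁, I4U := I₂, I4F := I₃, famE := famE, famU := famU, famF := famF, d4 := d4, N4 := N4 }

section OfRecord

variable {ι : Type} [Fintype ι] [DecidableEq ι]
  (F : OrthFlow ι) {ℓ₁ : ℝ} (hℓ₁ : 0 ≤ ℓ₁)
  (hLip : ∀ t (v : ι → ℝ), ((F.U t - 1) *ᵥ v) ⬝ᵥ ((F.U t - 1) *ᵥ v) ≤ (ℓ₁ * t) ^ 2 * (v ⬝ᵥ v))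
  (d ℓ : ℕ) (hℓ : 1 ≤ ℓ) (amin aplus m2plus : ℝ) (ha : 0 < amin) (hap : amin ≤ aplus)
  (creg β : ℝ) (hcreg : 0 ≤ creg) (hβ : 0 < β) (a' : ℝ) (ha' : 0 < a')
  (a m2 C a₀ p : ℝ) (ha0 : 0 < a) (hm : 0 ≤ m2) (hC : 0 ≤ C) (ha₀ : 0 ≤ a₀) (hp : 0 < p) (d₅ N₅ : ℕ)

/-- **The carrier bundle `X` with its B4 group set to the CONCRETE objects of the lit-balaban r01 lineage**: `famE` = the torus region-pair family
`torusPairFam` of [Balaban1983RegularityDecay] Theorem p. 573 at a (1.7)-regular field (big-block size `Kmod`), `famU` = the Prop.-2.3 family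
`regularFieldRegionsW` (nested finite unions of `L = ℓ+1`-blocks, every `Λ`, `a_k ∈ [a₋, a₊]`), `famF` = the Prop.-3.1′ family `regularFormSetting`,
`(d4, N4) = (d₅, N₅)`; family parameters: the flow `F`, `d`, `ℓ`, the windows `a₋ ≤ a₊`, `m²₊`, the (1.7) constants `(c, β)`, `a′`,
`(a, m², O(1), a₀, p)`. [cite: Balaban1983RegularityDecay, (1.1)–(1.7) pp.572–573, Props. 2.3 / 3.1′ p.574] -/
def withB4OfRecord (X : PrintedCarriersR) : PrintedCarriersR :=
  withB4 X (torusPairFam F d ℓ amin aplus m2plus creg β (Kmod F hℓ₁ hLip d ℓ hℓ amin aplus m2plus ha))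
    (regularFieldRegionsW (d := d) F (Nat.succ_le_succ (Nat.zero_le ℓ) : 1 ≤ ℓ + 1) amin aplus a' creg β m2plus)
    (regularFormSetting (d := d) F a m2 C a₀ p) d₅ N₅

include hap hcreg hβ ha' ha0 hm hC ha₀ hp in
/-- **Leaf `b4` OF THE N-BINDING HOLDS at the B4 objects of the lineage**: `DagDischargedII.B4LeafNN` for the substituted carriers is
`B4LeafRegular.leafNN_torusPairFam`, by name. [cite: Balaban1983RegularityDecay, Theorem (1.9)–(1.12) p.573 (0 ≤ α form), Prop. 2.3 of [1] p.574, Prop. 3.1′ of [2] p.574, Sect. 5 Theorem p.594 (kernel versions of the lit-balaban r01 lineage for its concrete families)] -/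
theorem b4N_withB4OfRecord (X : PrintedCarriersR) (Y : PrintedCarriers9X) (Z : PrintedCarriers11) (V : PrintedCarriers14R)
    (W : PrintedCarriers15) :
    (Upstream.ofPrintedAllXPN
      (withB4OfRecord F hℓ₁ hLip d ℓ hℓ amin aplus m2plus ha creg β a' a m2 C a₀ p d₅ N₅ X) Y Z V W).b4 :=
  leafNN_torusPairFam F hℓ₁ hLip d ℓ hℓ amin aplus m2plus ha hap creg β hcreg hβ ha' ha0 hm hC ha₀ hp d₅ N₅

include hap hcreg hβ ha' ha0 hm hC ha₀ hp in
/-- **Consequently the DAG node N01 (`Dag.B4_main` = «b4») holds at EVERY binding world whose upstream block is the N-binding over carriers with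
this B4 group**, every run `P` (venue form: `YMDAG.N01 w P`).  Bookkeeping over the lineage's theorem; whether these carriers are «the objects of
record» (Q-N00-2) and whether the binding of record is the N-binding (Q-N00-7) are rulings asked in the report, not asserted here.
[cite: Balaban1983RegularityDecay, Theorem p.573, Props. 2.3 / 3.1′ p.574, Sect. 5 Theorem p.594 (kernel versions of the lit-balaban r01 lineage)] -/
theorem b4_main_withB4OfRecord (X : PrintedCarriersR) (Y : PrintedCarriers9X) (Z : PrintedCarriers11) (V : PrintedCarriers14R)
    (W : PrintedCarriers15) (w : WorldP)
    (hw : w.up = fun _ => Upstream.ofPrintedAllXPN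
      (withB4OfRecord F hℓ₁ hLip d ℓ hℓ amin aplus m2plus ha creg β a' a m2 C a₀ p d₅ N₅ X) Y Z V W)
    (P : B12.RunParams) : Dag.B4_main (leavesP w P) := by
  show (w.up P).b4
  rw [hw]
  exact b4N_withB4OfRecord F hℓ₁ hLip d ℓ hℓ amin aplus m2plus ha hap creg β hcreg hβ a' ha' a m2 C a₀ p ha0 hm hC ha₀ hp
    d₅ N₅ X Y Z V W

end OfRecord

end Literature.MathematicalPhysics.QuantumFieldTheory.Balaban1983to89.Node00

end
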